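import Literature.AlgebraicGeometry.ModuliOfAbelianVarieties.SiegelCanonicalModel
import HarnessLib

/-!
# The `ℚ`-structure points `ptQ` of a `ℚ`-model of the Siegel tower are a BIJECTION `Sg.Mc_K(ℂ) ≃ Nm_K(ℂ)`
# ([Deligne 1971] Déf. 3.1 (b); [Milne ISV] §13: «the action of `Aut(ℂ/k)` on `V(ℂ)`»)

Topic `AlgebraicGeometry/ModuliOfAbelianVarieties`; namespace `Literature.AlgebraicGeometry.ModuliOfAbelianVarieties.SiegelRationalModel`.
THEOREMS ONLY (no definition, no named fact, no instance, no `sorry`; net Literature debt **0**).  Sequel of ★ (σ4)-D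
`SiegelCanonicalModel` (`SiegelRationalModel.ptQ`).  Cell hodgecm-mathlib (D-0151), banked GENERIC leaf R60-31 toward fan-B row I-7
(#60) `SiegelS1` (director g6 RULING s86 (2)(b)); `MUMFORD-LINE-SPEC.md` §3 step 6 («conclude by injectivity») and R60-29 (uniqueness of
the canonical model) consume it.

WHAT IS PROVED.  `R.ptQ K = (X(ℂ) ≃ (X ⊗_ℚ ℂ)(ℂ))⁻¹ ∘ (e_K⁻¹)_*` is a composite of an equivalence with push-forward along an
ISOMORPHISM, hence: `map_e_hom_map_e_inv` / `map_e_inv_map_e_hom` (push-forward along `e`, `e⁻¹` are mutually inverse on points),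
`ptQ_injective`, `ptQ_surjective`, `ptQ_bijective`, `ptQ_eq_ptQ_iff`, and the explicit preimage
`ptQ_map_e_hom_baseChangeEquiv` (the `[J, aK]`-form of surjectivity is ★ `exists_eq_ptQ_mk` of `SiegelRationalModelHeckeAction`).  So every statement
about `σ • ptQ_K P` ((62), Hecke) is a statement about ALL of `Nm_K(ℂ)`, and two points of `Sg.Mc_K(ℂ)` with the same `ptQ` are equal.
Nothing printed is asserted.  HC_CM is proved only modulo the 7 printed citations until rung 0 closes.

## References
* [Deligne1971TravauxShimura] P. Deligne, *Travaux de Shimura*, Sém. Bourbaki 389 (1971), Déf. 3.1 p. 136.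
* [Milne2005ShimuraVarieties] J. S. Milne, *Introduction to Shimura varieties* (2005), §13 p. 117.
* [Hartshorne1977] R. Hartshorne, *Algebraic Geometry*, II.3 Thm. 3.3.
-/

set_option autoImplicit false

noncomputable section

open CategoryTheory

namespace Literature.AlgebraicGeometry.ModuliOfAbelianVarieties

open Literature.AlgebraicGeometry.Motives (SchemeOver ComplexPoints AlgPoints)

namespace SiegelRationalModel

variable {g : ℕ} {δ : Fin g → ℕ} {Sg : SiegelComplexRecordSystem g δ} (R : SiegelRationalModel g δ Sg)

/-- Push-forward along `e_K` undoes push-forward along `e_K⁻¹` on complex points. [cite: Deligne1971TravauxShimura, Déf. 3.1 p. 136] -/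
theorem map_e_hom_map_e_inv (K : SiegelLevel δ) (P : ComplexPoints (Sg.Mc.obj K)) :
    AlgPoints.map (R.e.hom.app K) (AlgPoints.map (R.e.inv.app K) P) = P := by
  rw [← AlgPoints.map_comp_apply, Iso.inv_hom_id_app, AlgPoints.map_id, id]

/-- Push-forward along `e_K⁻¹` undoes push-forward along `e_K` on complex points. [cite: Deligne1971TravauxShimura, Déf. 3.1 p. 136] -/
theorem map_e_inv_map_e_hom (K : SiegelLevel δ)
    (Q : ComplexPoints ((R.Nm ⋙ Motives.baseChange ℚ ℂ).obj K)) :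
    AlgPoints.map (R.e.inv.app K) (AlgPoints.map (R.e.hom.app K) Q) = Q := by
  rw [← AlgPoints.map_comp_apply, Iso.hom_inv_id_app, AlgPoints.map_id, id]

/-- **`ptQ_K` is injective**: two complex points of `Sg.Mc_K` with the same `ℚ`-structure point coincide.
[cite: Deligne1971TravauxShimura, Déf. 3.1 p. 136] [cite: Milne2005ShimuraVarieties, §13 p. 117] -/
theorem ptQ_injective (K : SiegelLevel δ) : Function.Injective (R.ptQ K) := by
  intro P P' h
  rw [ptQ_def, ptQ_def] at h
  have hl : Function.LeftInverse (AlgPoints.map (R.e.hom.app K))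
      (AlgPoints.map (R.e.inv.app K) : ComplexPoints (Sg.Mc.obj K) → _) := R.map_e_hom_map_e_inv K
  exact hl.injective ((Equiv.injective _) h)

/-- `ptQ_K P = ptQ_K P′ ↔ P = P′`. [cite: Deligne1971TravauxShimura, Déf. 3.1 p. 136] -/
theorem ptQ_eq_ptQ_iff (K : SiegelLevel δ) (P P' : ComplexPoints (Sg.Mc.obj K)) :
    R.ptQ K P = R.ptQ K P' ↔ P = P' :=
  (R.ptQ_injective K).eq_iff

/-- The point of `Sg.Mc_K(ℂ)` under a point `Q` of `Nm_K(ℂ)`: `e_K ((X(ℂ) ≃ (X ⊗ ℂ)(ℂ)) Q)` has `ptQ` equal to `Q`.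
[cite: Deligne1971TravauxShimura, Déf. 3.1 p. 136] [cite: Hartshorne1977, II.3 Thm. 3.3] -/
theorem ptQ_map_e_hom_baseChangeEquiv (K : SiegelLevel δ) (Q : ComplexPoints (R.Nm.obj K)) :
    R.ptQ K (AlgPoints.map (R.e.hom.app K) (AlgPoints.baseChangeEquiv (algebraMap ℚ ℂ) (R.Nm.obj K) Q)) = Q := by
  rw [ptQ_def]
  have h1 : AlgPoints.map (R.e.inv.app K)
      (AlgPoints.map (R.e.hom.app K) (AlgPoints.baseChangeEquiv (algebraMap ℚ ℂ) (R.Nm.obj K) Q)) =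
        AlgPoints.baseChangeEquiv (algebraMap ℚ ℂ) (R.Nm.obj K) Q := R.map_e_inv_map_e_hom K _
  exact (congrArg (AlgPoints.baseChangeEquiv (algebraMap ℚ ℂ) (R.Nm.obj K)).symm h1).trans
    (Equiv.symm_apply_apply _ _)

/-- **`ptQ_K` is surjective**: every complex point of the `ℚ`-scheme `Nm_K` is the `ℚ`-structure point of a complex point of `Sg.Mc_K`.
[cite: Deligne1971TravauxShimura, Déf. 3.1 p. 136] [cite: Milne2005ShimuraVarieties, §13 p. 117] -/
theorem ptQ_surjective (K : SiegelLevel δ) : Function.Surjective (R.ptQ K) :=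
  fun Q => ⟨_, R.ptQ_map_e_hom_baseChangeEquiv K Q⟩

/-- **`ptQ_K : Sg.Mc_K(ℂ) → Nm_K(ℂ)` is a bijection.** [cite: Deligne1971TravauxShimura, Déf. 3.1 p. 136] -/
theorem ptQ_bijective (K : SiegelLevel δ) : Function.Bijective (R.ptQ K) :=
  ⟨R.ptQ_injective K, R.ptQ_surjective K⟩

end SiegelRationalModel

end Literature.AlgebraicGeometry.ModuliOfAbelianVarieties

end
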